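import Literature.Geometry.Riemannian.SphericalCylinderEntropyHeatEquation
import Literature.Geometry.Riemannian.SphericalZonalHamiltonHarnack
import HarnessLib

/-!
# Ambient calculus of the typed kernel on `ℝ⁶` and its backward heat equation on `N = S⁴ × ℝ`

Topic `Literature/Geometry/Riemannian`; continuation of `SphericalCylinderEntropyHeatEquation.lean`
(the zonal heat equation `∂_τ 𝔥 = (1 - s²) ∂_s² 𝔥 - 4 s ∂_s 𝔥` of the typed zonal kernel) and
`SphericalCylinderEntropyZonalSmooth.lean` (smoothness).  The typed kernel of route
`SmoothPoincare4/CylinderEntropy` is the function on `ℝ⁶`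

  `k(z) = cylKernel p τ z = 𝔥(τ, ⟨z', p'⟩) · G(z₅ - p₅)`,  `G(x) = e^{-x²/4τ}`,

and Hamilton's Harnack quadratic form of the crux `CylinderRungTwo` (stub
`stub_hamiltonMonotonicity`, `harnackQuadratic`) is written with its AMBIENT derivatives
`fderiv ℝ (cylKernel p τ) z`, `iteratedFDeriv ℝ 2 (cylKernel p τ) z`.  Proved here (everything; no
facts, no definitions), for `τ > 0` and every `z ∈ ℝ⁶`:

* `hasFDerivAt_cylKernel`, `fderiv_cylKernel_apply` —
  `Dk(z) v = (𝔥' ⟨v', p'⟩ - 𝔥 (z₅-p₅)/(2τ) v₅) G`;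
* `hasFDerivAt_fderiv_cylKernel`, `iteratedFDeriv_two_cylKernel_apply` —
  `D²k(z)(v, w) = (𝔥'' ⟨v',p'⟩⟨w',p'⟩ - 𝔥' (z₅-p₅)/(2τ) (v₅⟨w',p'⟩ + ⟨v',p'⟩w₅)
     + 𝔥 ((z₅-p₅)²/4τ² - 1/(2τ)) v₅ w₅) G`;
* `hasDerivAt_cylKernel_tau` — `∂_τ k = ((1-s²)𝔥'' - 4s𝔥') G + 𝔥 (z₅-p₅)²/(4τ²) G`;
* `laplacian_cylKernel` — `Δ_{ℝ⁶} k = (𝔥'' + 𝔥 ((z₅-p₅)²/4τ² - 1/(2τ))) G` for `|p'| = 1`;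
* `cylKernel_backward_heat` — **`∂_τ k = [Δ_{ℝ⁶} k - D²k(n,n) - 4 Dk(n)] + k/(2τ)`** with
  `n = (z', 0)`: on `N` the bracket is `Δ_N (k|_N)`, i.e. the typed kernel solves Hamilton's backward
  heat equation `∂_τ k = Δ_N k + k/(2τ)` of the `5`-manifold `N` up to the factor `(4πτ)^{1/2}` it
  omits — ingredient (ii) of the monotonicity formula for the typed density;
* `cylKernel_pos` — `k > 0` on `N` for `p ∈ N` (the tree's `zonal_pos`).

## References
* R. S. Hamilton, *Monotonicity formulas for parabolic flows on manifolds*, Comm. Anal. Geom. 1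
  (1993), 127–137, §4; *A matrix Harnack estimate for the heat equation*, ibid. 113–126.
-/

noncomputable section

open scoped BigOperators Topology ContDiff
open Filter Set Finset Literature.Geometry.Riemannian

namespace Literature.Geometry.Riemannian.SphericalCylinderEntropy

/-! ### The two linear forms -/

/-- `z ↦ ⟨z', p'⟩ = ∑_{i<5} z_i p_i` is the continuous linear form `∑_{i<5} p_i • proj_i`. [folklore] -/
theorem inner5_eq_clm (p : EuclideanSpace ℝ (Fin 6)) :
    (fun z : EuclideanSpace ℝ (Fin 6) => ∑ i : Fin 5, z (Fin.castSucc i) * p (Fin.castSucc i)) =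
      ⇑(∑ i : Fin 5, p (Fin.castSucc i) • (EuclideanSpace.proj (Fin.castSucc i) :
        EuclideanSpace ℝ (Fin 6) →L[ℝ] ℝ)) := by
  funext z
  simp [mul_comm]

/-- The derivative of `z ↦ ⟨z', p'⟩` is the linear form itself. [folklore] -/
theorem hasFDerivAt_inner5 (p z : EuclideanSpace ℝ (Fin 6)) :
    HasFDerivAt (fun z : EuclideanSpace ℝ (Fin 6) => ∑ i : Fin 5, z (Fin.castSucc i) * p (Fin.castSucc i))
      (∑ i : Fin 5, p (Fin.castSucc i) • (EuclideanSpace.proj (Fin.castSucc i) :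
        EuclideanSpace ℝ (Fin 6) →L[ℝ] ℝ)) z := by
  rw [inner5_eq_clm]
  exact ContinuousLinearMap.hasFDerivAt _

/-- Evaluation of the linear form `∑_{i<5} p_i • proj_i`. [folklore] -/
theorem clm5_apply (p w : EuclideanSpace ℝ (Fin 6)) :
    (∑ i : Fin 5, p (Fin.castSucc i) • (EuclideanSpace.proj (Fin.castSucc i) :
        EuclideanSpace ℝ (Fin 6) →L[ℝ] ℝ)) w = ∑ i : Fin 5, w (Fin.castSucc i) * p (Fin.castSucc i) := by
  have h := congrFun (inner5_eq_clm p) w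
  exact h.symm

/-- The derivative of `z ↦ z₅ - p₅` is `proj₅`. [folklore] -/
theorem hasFDerivAt_coord5_sub (p z : EuclideanSpace ℝ (Fin 6)) :
    HasFDerivAt (fun z : EuclideanSpace ℝ (Fin 6) => z 5 - p 5)
      (EuclideanSpace.proj (5 : Fin 6) : EuclideanSpace ℝ (Fin 6) →L[ℝ] ℝ) z := by
  have h : HasFDerivAt (fun z : EuclideanSpace ℝ (Fin 6) => z 5)
      (EuclideanSpace.proj (5 : Fin 6) : EuclideanSpace ℝ (Fin 6) →L[ℝ] ℝ) z := by
    have he : (fun z : EuclideanSpace ℝ (Fin 6) => z 5) =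
        ⇑(EuclideanSpace.proj (5 : Fin 6) : EuclideanSpace ℝ (Fin 6) →L[ℝ] ℝ) := by
      funext z; simp
    rw [he]; exact ContinuousLinearMap.hasFDerivAt _
  exact h.sub_const (p 5)

/-- Evaluation of `proj₅`. [folklore] -/
theorem proj5_apply (w : EuclideanSpace ℝ (Fin 6)) :
    (EuclideanSpace.proj (5 : Fin 6) : EuclideanSpace ℝ (Fin 6) →L[ℝ] ℝ) w = w 5 := by simp

/-! ### The Gaussian factor -/

/-- `(e^{-(x-c)²/4τ})' = -(x-c)/(2τ) · e^{-(x-c)²/4τ}`. [folklore] -/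
theorem hasDerivAt_gaussFactor {τ : ℝ} (hτ : τ ≠ 0) (c x : ℝ) :
    HasDerivAt (fun x : ℝ => Real.exp (-((x - c) ^ 2) / (4 * τ)))
      (-(x - c) / (2 * τ) * Real.exp (-((x - c) ^ 2) / (4 * τ))) x := by
  have h := ((((hasDerivAt_id x).sub_const c).fun_pow 2).neg.div_const (4 * τ)).exp
  refine h.congr_deriv ?_
  simp only [id, Nat.cast_ofNat, pow_one, mul_one, Nat.add_one_sub_one]
  rw [mul_comm]
  congr 1
  field_simp
  ring

/-- The ambient derivative of the Gaussian factor `z ↦ e^{-(z₅-p₅)²/4τ}`. [folklore] -/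
theorem hasFDerivAt_gaussFactor (p : EuclideanSpace ℝ (Fin 6)) {τ : ℝ} (hτ : τ ≠ 0)
    (z : EuclideanSpace ℝ (Fin 6)) :
    HasFDerivAt (fun z : EuclideanSpace ℝ (Fin 6) => Real.exp (-((z 5 - p 5) ^ 2) / (4 * τ)))
      ((-(z 5 - p 5) / (2 * τ) * Real.exp (-((z 5 - p 5) ^ 2) / (4 * τ))) •
        (EuclideanSpace.proj (5 : Fin 6) : EuclideanSpace ℝ (Fin 6) →L[ℝ] ℝ)) z := by
  have h1 : HasFDerivAt (fun z : EuclideanSpace ℝ (Fin 6) => z 5)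
      (EuclideanSpace.proj (5 : Fin 6) : EuclideanSpace ℝ (Fin 6) →L[ℝ] ℝ) z := by
    have he : (fun z : EuclideanSpace ℝ (Fin 6) => z 5) =
        ⇑(EuclideanSpace.proj (5 : Fin 6) : EuclideanSpace ℝ (Fin 6) →L[ℝ] ℝ) := by
      funext z; simp
    rw [he]; exact ContinuousLinearMap.hasFDerivAt _
  exact (hasDerivAt_gaussFactor hτ (p 5) (z 5)).comp_hasFDerivAt z h1

/-- The ambient derivative of the coefficient `z ↦ -(z₅-p₅)/(2τ)`. [folklore] -/
theorem hasFDerivAt_gaussCoeff (p : EuclideanSpace ℝ (Fin 6)) (τ : ℝ) (z : EuclideanSpace ℝ (Fin 6)) :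
    HasFDerivAt (fun z : EuclideanSpace ℝ (Fin 6) => -(z 5 - p 5) / (2 * τ))
      ((-(1 / (2 * τ))) • (EuclideanSpace.proj (5 : Fin 6) : EuclideanSpace ℝ (Fin 6) →L[ℝ] ℝ)) z := by
  have h := ((hasFDerivAt_coord5_sub p z).neg).mul_const (1 / (2 * τ))  -- fun z => -(z5-p5) * (1/(2τ))
  have hfun : (fun z : EuclideanSpace ℝ (Fin 6) => -(z 5 - p 5) / (2 * τ)) =
      fun z => -(z 5 - p 5) * (1 / (2 * τ)) := by funext z; ring
  rw [hfun]
  refine h.congr_fderiv ?_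
  ext w
  simp only [FunLike.coe_smul, Pi.smul_apply, neg_apply, smul_eq_mul, proj5_apply]
  ring

/-! ### The zonal factor -/

/-- The ambient derivative of the zonal factor `z ↦ 𝔥(τ, ⟨z', p'⟩)` (chain rule). [folklore] -/
theorem hasFDerivAt_zonal_comp (p : EuclideanSpace ℝ (Fin 6)) {τ : ℝ} (hτ : 0 < τ)
    (z : EuclideanSpace ℝ (Fin 6)) :
    HasFDerivAt (fun z : EuclideanSpace ℝ (Fin 6) => zonal τ (∑ i : Fin 5, z (Fin.castSucc i) * p (Fin.castSucc i)))
      ((deriv (zonal τ) (∑ i : Fin 5, z (Fin.castSucc i) * p (Fin.castSucc i))) •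
        (∑ i : Fin 5, p (Fin.castSucc i) • (EuclideanSpace.proj (Fin.castSucc i) :
          EuclideanSpace ℝ (Fin 6) →L[ℝ] ℝ))) z :=
  ((hasDerivAt_zonal_tsum hτ _).differentiableAt.hasDerivAt).comp_hasFDerivAt z (hasFDerivAt_inner5 p z)

/-- The ambient derivative of `z ↦ ∂_s 𝔥(τ, ⟨z', p'⟩)`. [folklore] -/
theorem hasFDerivAt_deriv_zonal_comp (p : EuclideanSpace ℝ (Fin 6)) {τ : ℝ} (hτ : 0 < τ)
    (z : EuclideanSpace ℝ (Fin 6)) :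
    HasFDerivAt (fun z : EuclideanSpace ℝ (Fin 6) =>
        deriv (zonal τ) (∑ i : Fin 5, z (Fin.castSucc i) * p (Fin.castSucc i)))
      ((deriv (deriv (zonal τ)) (∑ i : Fin 5, z (Fin.castSucc i) * p (Fin.castSucc i))) •
        (∑ i : Fin 5, p (Fin.castSucc i) • (EuclideanSpace.proj (Fin.castSucc i) :
          EuclideanSpace ℝ (Fin 6) →L[ℝ] ℝ))) z :=
  ((hasDerivAt_deriv_zonal_tsum hτ _).differentiableAt.hasDerivAt).comp_hasFDerivAt z
    (hasFDerivAt_inner5 p z)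

/-! ### First derivative of the typed kernel -/

/-- **The ambient derivative of the typed kernel** as a continuous linear form:
`Dk(z) = (G 𝔥') • ℓ + (𝔥 G') • proj₅`, `ℓ = ⟨·', p'⟩`, `G = e^{-(z₅-p₅)²/4τ}`. [folklore] -/
theorem hasFDerivAt_cylKernel (p : EuclideanSpace ℝ (Fin 6)) {τ : ℝ} (hτ : 0 < τ)
    (z : EuclideanSpace ℝ (Fin 6)) :
    HasFDerivAt (cylKernel p τ)
      ((Real.exp (-((z 5 - p 5) ^ 2) / (4 * τ)) *
          deriv (zonal τ) (∑ i : Fin 5, z (Fin.castSucc i) * p (Fin.castSucc i))) •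
        (∑ i : Fin 5, p (Fin.castSucc i) • (EuclideanSpace.proj (Fin.castSucc i) :
          EuclideanSpace ℝ (Fin 6) →L[ℝ] ℝ)) +
      (zonal τ (∑ i : Fin 5, z (Fin.castSucc i) * p (Fin.castSucc i)) *
          (-(z 5 - p 5) / (2 * τ) * Real.exp (-((z 5 - p 5) ^ 2) / (4 * τ)))) •
        (EuclideanSpace.proj (5 : Fin 6) : EuclideanSpace ℝ (Fin 6) →L[ℝ] ℝ)) z := by
  have h := (hasFDerivAt_zonal_comp p hτ z).mul (hasFDerivAt_gaussFactor p hτ.ne' z)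
  have hfun : cylKernel p τ = (fun z => zonal τ (∑ i : Fin 5, z (Fin.castSucc i) * p (Fin.castSucc i))) *
      fun z => Real.exp (-((z 5 - p 5) ^ 2) / (4 * τ)) := funext fun z => cylKernel_eq p τ z
  rw [hfun]
  refine h.congr_fderiv ?_
  rw [smul_smul, smul_smul, add_comm]

/-- **First ambient derivative of the typed kernel**: for `k = cylKernel p τ`, `s = ⟨z', p'⟩`,
`G = e^{-(z₅-p₅)²/4τ}`: `Dk(z) v = (𝔥'(s) ⟨v', p'⟩ - 𝔥(s) (z₅-p₅)/(2τ) v₅) G`. [folklore] -/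
theorem fderiv_cylKernel_apply (p : EuclideanSpace ℝ (Fin 6)) {τ : ℝ} (hτ : 0 < τ)
    (z v : EuclideanSpace ℝ (Fin 6)) :
    fderiv ℝ (cylKernel p τ) z v =
      (deriv (zonal τ) (∑ i : Fin 5, z (Fin.castSucc i) * p (Fin.castSucc i)) *
          (∑ i : Fin 5, v (Fin.castSucc i) * p (Fin.castSucc i))
        - zonal τ (∑ i : Fin 5, z (Fin.castSucc i) * p (Fin.castSucc i)) *
          ((z 5 - p 5) / (2 * τ)) * v 5) * Real.exp (-((z 5 - p 5) ^ 2) / (4 * τ)) := by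
  rw [(hasFDerivAt_cylKernel p hτ z).fderiv, FunLike.coe_add, Pi.add_apply,
    FunLike.coe_smul, FunLike.coe_smul, Pi.smul_apply, Pi.smul_apply,
    clm5_apply, proj5_apply, smul_eq_mul, smul_eq_mul]
  ring


/-! ### Second derivative of the typed kernel -/

/-- The derivative of the linear-form-valued map `z ↦ Dk(z)` (product and chain rules). [folklore] -/
theorem hasFDerivAt_fderiv_cylKernel (p : EuclideanSpace ℝ (Fin 6)) {τ : ℝ} (hτ : 0 < τ)
    (z : EuclideanSpace ℝ (Fin 6)) :
    HasFDerivAt (fderiv ℝ (cylKernel p τ))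
      ((Real.exp (-((z 5 - p 5) ^ 2) / (4 * τ)) •
            ((deriv (deriv (zonal τ)) (∑ i : Fin 5, z (Fin.castSucc i) * p (Fin.castSucc i))) •
              (∑ i : Fin 5, p (Fin.castSucc i) • (EuclideanSpace.proj (Fin.castSucc i) :
                EuclideanSpace ℝ (Fin 6) →L[ℝ] ℝ))) +
          (deriv (zonal τ) (∑ i : Fin 5, z (Fin.castSucc i) * p (Fin.castSucc i))) •
            ((-(z 5 - p 5) / (2 * τ) * Real.exp (-((z 5 - p 5) ^ 2) / (4 * τ))) •
              (EuclideanSpace.proj (5 : Fin 6) : EuclideanSpace ℝ (Fin 6) →L[ℝ] ℝ))).smulRight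
          (∑ i : Fin 5, p (Fin.castSucc i) • (EuclideanSpace.proj (Fin.castSucc i) :
            EuclideanSpace ℝ (Fin 6) →L[ℝ] ℝ)) +
        ((zonal τ (∑ i : Fin 5, z (Fin.castSucc i) * p (Fin.castSucc i))) •
            ((-(z 5 - p 5) / (2 * τ)) •
                ((-(z 5 - p 5) / (2 * τ) * Real.exp (-((z 5 - p 5) ^ 2) / (4 * τ))) •
                  (EuclideanSpace.proj (5 : Fin 6) : EuclideanSpace ℝ (Fin 6) →L[ℝ] ℝ)) +
              (Real.exp (-((z 5 - p 5) ^ 2) / (4 * τ))) •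
                ((-(1 / (2 * τ))) • (EuclideanSpace.proj (5 : Fin 6) : EuclideanSpace ℝ (Fin 6) →L[ℝ] ℝ))) +
          (-(z 5 - p 5) / (2 * τ) * Real.exp (-((z 5 - p 5) ^ 2) / (4 * τ))) •
            ((deriv (zonal τ) (∑ i : Fin 5, z (Fin.castSucc i) * p (Fin.castSucc i))) •
              (∑ i : Fin 5, p (Fin.castSucc i) • (EuclideanSpace.proj (Fin.castSucc i) :
                EuclideanSpace ℝ (Fin 6) →L[ℝ] ℝ)))).smulRight
          (EuclideanSpace.proj (5 : Fin 6) : EuclideanSpace ℝ (Fin 6) →L[ℝ] ℝ)) z := by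
  have hA := (hasFDerivAt_gaussFactor p hτ.ne' z).mul (hasFDerivAt_deriv_zonal_comp p hτ z)
  have hB := (hasFDerivAt_zonal_comp p hτ z).mul
    ((hasFDerivAt_gaussCoeff p τ z).mul (hasFDerivAt_gaussFactor p hτ.ne' z))
  have heq : fderiv ℝ (cylKernel p τ) = fun z =>
      ((fun z : EuclideanSpace ℝ (Fin 6) => Real.exp (-((z 5 - p 5) ^ 2) / (4 * τ))) *
          (fun z : EuclideanSpace ℝ (Fin 6) =>
            deriv (zonal τ) (∑ i : Fin 5, z (Fin.castSucc i) * p (Fin.castSucc i)))) z •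
        (∑ i : Fin 5, p (Fin.castSucc i) • (EuclideanSpace.proj (Fin.castSucc i) :
          EuclideanSpace ℝ (Fin 6) →L[ℝ] ℝ)) +
      ((fun z : EuclideanSpace ℝ (Fin 6) =>
            zonal τ (∑ i : Fin 5, z (Fin.castSucc i) * p (Fin.castSucc i))) *
          ((fun z : EuclideanSpace ℝ (Fin 6) => -(z 5 - p 5) / (2 * τ)) *
            fun z : EuclideanSpace ℝ (Fin 6) => Real.exp (-((z 5 - p 5) ^ 2) / (4 * τ)))) z •
        (EuclideanSpace.proj (5 : Fin 6) : EuclideanSpace ℝ (Fin 6) →L[ℝ] ℝ) := by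
    funext z
    rw [(hasFDerivAt_cylKernel p hτ z).fderiv]
    rfl
  rw [heq]
  have hA' := hA.smul_const (∑ i : Fin 5, p (Fin.castSucc i) •
    (EuclideanSpace.proj (Fin.castSucc i) : EuclideanSpace ℝ (Fin 6) →L[ℝ] ℝ))
  have hB' := hB.smul_const (EuclideanSpace.proj (5 : Fin 6) : EuclideanSpace ℝ (Fin 6) →L[ℝ] ℝ)
  exact (hA'.add hB').congr_fderiv (by rfl)

/-- **Second ambient derivative of the typed kernel**:
`D²k(z)(v, w) = (𝔥'' ⟨v',p'⟩⟨w',p'⟩ - 𝔥' (z₅-p₅)/(2τ) (v₅⟨w',p'⟩ + ⟨v',p'⟩w₅) + 𝔥 ((z₅-p₅)²/4τ² - 1/(2τ)) v₅ w₅) G`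
(`iteratedFDeriv ℝ 2` evaluated on `![v, w]`). [folklore] -/
theorem iteratedFDeriv_two_cylKernel_apply (p : EuclideanSpace ℝ (Fin 6)) {τ : ℝ} (hτ : 0 < τ)
    (z v w : EuclideanSpace ℝ (Fin 6)) :
    iteratedFDeriv ℝ 2 (cylKernel p τ) z ![v, w] =
      (deriv (deriv (zonal τ)) (∑ i : Fin 5, z (Fin.castSucc i) * p (Fin.castSucc i)) *
          (∑ i : Fin 5, v (Fin.castSucc i) * p (Fin.castSucc i)) *
          (∑ i : Fin 5, w (Fin.castSucc i) * p (Fin.castSucc i))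
        - deriv (zonal τ) (∑ i : Fin 5, z (Fin.castSucc i) * p (Fin.castSucc i)) *
          ((z 5 - p 5) / (2 * τ)) *
          (v 5 * (∑ i : Fin 5, w (Fin.castSucc i) * p (Fin.castSucc i)) +
            (∑ i : Fin 5, v (Fin.castSucc i) * p (Fin.castSucc i)) * w 5)
        + zonal τ (∑ i : Fin 5, z (Fin.castSucc i) * p (Fin.castSucc i)) *
          ((z 5 - p 5) ^ 2 / (4 * τ ^ 2) - 1 / (2 * τ)) * v 5 * w 5)
        * Real.exp (-((z 5 - p 5) ^ 2) / (4 * τ)) := by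
  rw [iteratedFDeriv_two_apply, (hasFDerivAt_fderiv_cylKernel p hτ z).fderiv]
  simp only [Matrix.cons_val_zero, Matrix.cons_val_one, FunLike.coe_add, Pi.add_apply,
    FunLike.coe_smul, Pi.smul_apply, ContinuousLinearMap.smulRight_apply, smul_eq_mul, clm5_apply,
    proj5_apply]
  field_simp
  ring


/-! ### The scale derivative and the ambient backward heat equation -/

/-- `∂_τ e^{-x²/4τ} = x²/(4τ²) · e^{-x²/4τ}`. [folklore] -/
theorem hasDerivAt_gaussFactor_tau {τ : ℝ} (hτ : τ ≠ 0) (x : ℝ) :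
    HasDerivAt (fun τ' : ℝ => Real.exp (-(x ^ 2) / (4 * τ')))
      (x ^ 2 / (4 * τ ^ 2) * Real.exp (-(x ^ 2) / (4 * τ))) τ := by
  have h := ((hasDerivAt_inv hτ).const_mul (-(x ^ 2) / 4)).exp
  have hfun : (fun τ' : ℝ => Real.exp (-(x ^ 2) / (4 * τ'))) =
      fun y => Real.exp (-(x ^ 2) / 4 * y⁻¹) := by
    funext y
    congr 1
    ring
  rw [hfun]
  refine h.congr_deriv ?_
  have harg : -(x ^ 2) / 4 * τ⁻¹ = -(x ^ 2) / (4 * τ) := by ring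
  rw [harg, mul_comm]
  congr 1
  field_simp

/-- **The scale derivative of the typed kernel**: `∂_τ k = (∂_τ 𝔥) G + 𝔥 ∂_τ G` with
`∂_τ 𝔥 = (1 - s²) 𝔥'' - 4 s 𝔥'` (`zonal_heat_equation`) and `∂_τ G = (z₅-p₅)²/(4τ²) G`. [folklore] -/
theorem hasDerivAt_cylKernel_tau (p : EuclideanSpace ℝ (Fin 6)) {τ : ℝ} (hτ : 0 < τ)
    (z : EuclideanSpace ℝ (Fin 6)) :
    HasDerivAt (fun τ' : ℝ => cylKernel p τ' z)
      (((1 - (∑ i : Fin 5, z (Fin.castSucc i) * p (Fin.castSucc i)) ^ 2) *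
            deriv (deriv (zonal τ)) (∑ i : Fin 5, z (Fin.castSucc i) * p (Fin.castSucc i)) -
          4 * (∑ i : Fin 5, z (Fin.castSucc i) * p (Fin.castSucc i)) *
            deriv (zonal τ) (∑ i : Fin 5, z (Fin.castSucc i) * p (Fin.castSucc i))) *
          Real.exp (-((z 5 - p 5) ^ 2) / (4 * τ)) +
        zonal τ (∑ i : Fin 5, z (Fin.castSucc i) * p (Fin.castSucc i)) *
          ((z 5 - p 5) ^ 2 / (4 * τ ^ 2) * Real.exp (-((z 5 - p 5) ^ 2) / (4 * τ)))) τ := by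
  have h := (hasDerivAt_zonal_tau_heat hτ (∑ i : Fin 5, z (Fin.castSucc i) * p (Fin.castSucc i))).mul
    (hasDerivAt_gaussFactor_tau hτ.ne' (z 5 - p 5))
  exact h

/-! #### Evaluations on the coordinate frame and on the radial normal -/

/-- `5 = Fin.last 5` in `Fin 6`. [folklore] -/
theorem five_eq_last : (5 : Fin 6) = Fin.last 5 := rfl

/-- The horizontal frame vectors have no vertical component. [folklore] -/
theorem single_castSucc_apply_five (j : Fin 5) :
    (EuclideanSpace.single (Fin.castSucc j) (1 : ℝ) : EuclideanSpace ℝ (Fin 6)) 5 = 0 := by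
  have h : (5 : Fin 6) ≠ Fin.castSucc j := by
    rw [five_eq_last]
    exact (Fin.castSucc_lt_last j).ne'
  simp [h]

/-- The vertical frame vector has no horizontal components. [folklore] -/
theorem single_five_apply_castSucc (j : Fin 5) :
    (EuclideanSpace.single (5 : Fin 6) (1 : ℝ) : EuclideanSpace ℝ (Fin 6)) (Fin.castSucc j) = 0 := by
  have h : Fin.castSucc j ≠ (5 : Fin 6) := by
    rw [five_eq_last]
    exact (Fin.castSucc_lt_last j).ne
  simp [h]

/-- The vertical frame vector is `e₅`. [folklore] -/
theorem single_five_apply_five :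
    (EuclideanSpace.single (5 : Fin 6) (1 : ℝ) : EuclideanSpace ℝ (Fin 6)) 5 = 1 := by
  simp

/-- `⟨e_j', p'⟩ = p_j` for `j < 5`. [folklore] -/
theorem inner5_single_castSucc (p : EuclideanSpace ℝ (Fin 6)) (j : Fin 5) :
    ∑ i : Fin 5, (EuclideanSpace.single (Fin.castSucc j) (1 : ℝ) : EuclideanSpace ℝ (Fin 6))
        (Fin.castSucc i) * p (Fin.castSucc i) = p (Fin.castSucc j) := by
  simp [Fin.castSucc_inj]

/-- `⟨e₅', p'⟩ = 0`. [folklore] -/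
theorem inner5_single_five (p : EuclideanSpace ℝ (Fin 6)) :
    ∑ i : Fin 5, (EuclideanSpace.single (5 : Fin 6) (1 : ℝ) : EuclideanSpace ℝ (Fin 6))
        (Fin.castSucc i) * p (Fin.castSucc i) = 0 := by
  simp only [single_five_apply_castSucc, zero_mul, Finset.sum_const_zero]

/-- `⟨n', p'⟩ = ⟨z', p'⟩` for the radial field `n = (z', 0)`. [folklore] -/
theorem inner5_padL_truncL (p z : EuclideanSpace ℝ (Fin 6)) :
    ∑ i : Fin 5, (Literature.Geometry.Manifold.CylinderSlice.padL (truncL z)) (Fin.castSucc i) *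
        p (Fin.castSucc i) = ∑ i : Fin 5, z (Fin.castSucc i) * p (Fin.castSucc i) := by
  simp

/-- The radial field `n = (z', 0)` is horizontal. [folklore] -/
theorem padL_truncL_apply_five (z : EuclideanSpace ℝ (Fin 6)) :
    (Literature.Geometry.Manifold.CylinderSlice.padL (truncL z)) 5 = 0 :=
  Literature.Geometry.Manifold.CylinderSlice.padL_apply_last _

/-- **The ambient Laplacian of the typed kernel**: for `|p'| = 1`,
`Δ_{ℝ⁶} k = ∑_i D²k(e_i, e_i) = (𝔥'' + 𝔥 ((z₅-p₅)²/4τ² - 1/(2τ))) · G`. [folklore] -/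
theorem laplacian_cylKernel (p : EuclideanSpace ℝ (Fin 6)) (hp : ∑ i : Fin 5, p (Fin.castSucc i) ^ 2 = 1)
    {τ : ℝ} (hτ : 0 < τ) (z : EuclideanSpace ℝ (Fin 6)) :
    ∑ i : Fin 6, iteratedFDeriv ℝ 2 (cylKernel p τ) z
        ![EuclideanSpace.single i (1 : ℝ), EuclideanSpace.single i (1 : ℝ)] =
      (deriv (deriv (zonal τ)) (∑ i : Fin 5, z (Fin.castSucc i) * p (Fin.castSucc i)) +
        zonal τ (∑ i : Fin 5, z (Fin.castSucc i) * p (Fin.castSucc i)) *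
          ((z 5 - p 5) ^ 2 / (4 * τ ^ 2) - 1 / (2 * τ))) * Real.exp (-((z 5 - p 5) ^ 2) / (4 * τ)) := by
  rw [Fin.sum_univ_castSucc]
  simp only [iteratedFDeriv_two_cylKernel_apply p hτ, inner5_single_castSucc, single_castSucc_apply_five,
    ← five_eq_last, inner5_single_five, single_five_apply_five, mul_zero, zero_mul, add_zero, sub_zero,
    mul_one, zero_add]
  rw [← Finset.sum_mul]
  have hsum : ∑ i : Fin 5, deriv (deriv (zonal τ)) (∑ i : Fin 5, z (Fin.castSucc i) * p (Fin.castSucc i)) *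
      p (Fin.castSucc i) * p (Fin.castSucc i) =
      deriv (deriv (zonal τ)) (∑ i : Fin 5, z (Fin.castSucc i) * p (Fin.castSucc i)) := by
    calc _ = deriv (deriv (zonal τ)) (∑ i : Fin 5, z (Fin.castSucc i) * p (Fin.castSucc i)) *
          ∑ i : Fin 5, p (Fin.castSucc i) ^ 2 := by
          rw [Finset.mul_sum]
          exact Finset.sum_congr rfl fun i _ => by ring
      _ = _ := by rw [hp, mul_one]
  rw [hsum]
  ring

/-- **The ambient backward heat equation of the typed kernel.** For `|p'| = 1` (e.g. `p ∈ N`),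
`τ > 0` and EVERY `z ∈ ℝ⁶`, with the radial field `n = (z', 0) = padL (truncL z)` and the coordinate
frame `e_i`: `∂_τ k = [Δ_{ℝ⁶} k - D²k(n, n) - 4 Dk(n)] + k/(2τ)` for `k = cylKernel p τ`.  On
`N = S⁴ × ℝ` (`|z'| = 1`, `n` the unit normal) the bracket is the Laplace–Beltrami operator of `N`
applied to `k|_N` (`Δ_N f = Δ_{ℝ⁶} f - D²f(n,n) - H_N ∂_n f`, `H_N = 4`), so this is
`∂_τ k = Δ_N k + k/(2τ)`: the typed kernel `k = vol(S⁴) (4πτ)^{1/2} K_N(·, p; τ)` is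
`(4πτ)^{1/2}` times a positive solution of the backward heat equation of `N` — ingredient (ii) of
Hamilton's monotonicity formula for the typed density (in zonal form: `zonal_heat_equation` for
`𝔥` and `∂_τ G = ∂₅² G + G/(2τ)` for the prefactor-free Gaussian `G`). [cite: Hamilton1993, §4] -/
theorem cylKernel_backward_heat (p : EuclideanSpace ℝ (Fin 6)) (hp : ∑ i : Fin 5, p (Fin.castSucc i) ^ 2 = 1)
    {τ : ℝ} (hτ : 0 < τ) (z : EuclideanSpace ℝ (Fin 6)) :
    deriv (fun τ' : ℝ => cylKernel p τ' z) τ =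
      (∑ i : Fin 6, iteratedFDeriv ℝ 2 (cylKernel p τ) z
          ![EuclideanSpace.single i (1 : ℝ), EuclideanSpace.single i (1 : ℝ)])
        - iteratedFDeriv ℝ 2 (cylKernel p τ) z
          ![Literature.Geometry.Manifold.CylinderSlice.padL (truncL z),
            Literature.Geometry.Manifold.CylinderSlice.padL (truncL z)]
        - 4 * fderiv ℝ (cylKernel p τ) z (Literature.Geometry.Manifold.CylinderSlice.padL (truncL z))
        + cylKernel p τ z / (2 * τ) := by
  rw [(hasDerivAt_cylKernel_tau p hτ z).deriv, laplacian_cylKernel p hp hτ z,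
    iteratedFDeriv_two_cylKernel_apply p hτ, fderiv_cylKernel_apply p hτ, inner5_padL_truncL,
    padL_truncL_apply_five, cylKernel_eq]
  field_simp
  ring


/-! ### Positivity on `N` -/

/-- **The typed kernel is strictly positive on `N`** for a centre `p ∈ N` and `τ > 0`
(`𝔥(τ, ·) > 0` on `[-1, 1]`, the tree's `SphericalZonalKernelSeries.zonal_pos`, and `|⟨z', p'⟩| ≤ 1`).
[folklore] -/
theorem cylKernel_pos {p z : EuclideanSpace ℝ (Fin 6)} (hp : ∑ i : Fin 5, p (Fin.castSucc i) ^ 2 = 1)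
    (hz : ∑ i : Fin 5, z (Fin.castSucc i) ^ 2 = 1) {τ : ℝ} (hτ : 0 < τ) : 0 < cylKernel p τ z := by
  rw [cylKernel_eq]
  refine mul_pos (SphericalZonalKernelSeries.zonal_pos hτ _ (abs_le.1 (abs_sum_mul_le_one hz hp)))
    (Real.exp_pos _)

end Literature.Geometry.Riemannian.SphericalCylinderEntropy

end
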